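import Summits.BirchSwinnertonDyer.BirchSwinnertonDyer.Theorems.PrintCFramBottomClassIndexLawFiveLeBorelKummerDescent
import HarnessLib

/-!
# Route `PrintCFram`, crux C2 `BottomClassIndexLawFiveLe` (stmt-BirchSwinnertonDyer-20372), line
# `eisenstein-resource-bdp-line` (S2 `stub_kolyvaginUpper_borelCM_pairSum`, the new hypothesis at
# level `p^M`): **the `𝔭`-adic depth of a Kummer class is the `𝔭`-adic divisibility of the point** —
# over `F ∋ √−p`, all values of `κ_Q` (`p^M Q = P ∈ W(F)`) lie in `W[𝔭^k] = ker μ^k` iff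
# `μ_F^k P ∈ p^M · W(F)`
# (cell `bsd-print-cfram`, seat `bsd-line-cfram-p1-w2` g5; helper `--supports` 20372; 0 facts, 0 defs)

HONEST FRAMING. Nothing about BSD is proved here, and nothing of S2 itself. File 11 treated the level
`p` / depth `1` case (`κ_Q` leaves `W[𝔭]` iff `P ∉ √−p·W(F)`). This file is the level-`p^M`, depth-`k`
statement matching the TOP-LAYER hypotheses of the `𝔭`-adic McCallum (2)
(`exists_h1Eval_eq_pow_of_cmRamified`, file 8e) and of `exists_h1Eval_conj_mul_order_of_cmRamified`
(file 8f): for `F ∋ √−p` with `(p−1) ∤ [F:ℚ]`, `P ∈ W(F)`, `p^M Q = P` and any `k`,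
  «some evaluation of `κ_Q ∈ H¹(F, W[p^M])` on `Γ_{F(W[p^M])}` lies outside `ker μ^k`»
  iff `μ_F^k P ∉ p^M · W(F)`
(`apply_pow_smul_eq_of_sqrt_mem`: `μ_F^k` commutes with `Γ_F`; descent of `R` from
`W(F̄)^{Γ_{F(W[p^M])}}` to `W(F) + W[p^M]` by (α) over `F` at level `p^M`, file 9, and
`kummerClassTorsion_eq_zero_iff`). With `μ_F^{2M} = ±p^M` this says: the largest `k` with all values
of `κ_Q` in `W[𝔭^k]` is the largest `k` with `P ∈ 𝔭^{k}`-divisible position — the `𝔭`-adic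
valuation of `P` in `W(F)` modulo `p^M`, i.e. the `𝔭`-part of the index that an `𝒪_𝔭`-Kolyvagin bound
controls. THEOREMS ONLY; no definition, no named fact, no `sorry`. BSD is not proved by any of this;
no summit statement is proved by this seat.
References: [GrossLMS1991] §9; [McCallumLMS1991] §3; [SilvermanAEC2009] VIII.2; [Rubin1999] Cor. 5.5.
-/

set_option autoImplicit false
-- `…BirchSwinnertonDyer.BirchSwinnertonDyer.Theorems…` is the problem's mandated namespace (D-0017).
set_option linter.dupNamespace false

noncomputable section

open scoped Classical

namespace Summit.BirchSwinnertonDyer.BirchSwinnertonDyer.Theorems.PrintCFram.BorelKolyvaginPairing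

open WeierstrassCurve Field Literature.NumberTheory.EllipticCurves
  Literature.NumberTheory.EllipticCurves.KolyvaginPairing Literature.NumberTheory.GaloisRepresentations
  Literature.NumberTheory.EllipticCurves.Rank1Residual
  Summit.BirchSwinnertonDyer.BirchSwinnertonDyer.Theorems.PrintCFram.BorelHomothety
  Summit.BirchSwinnertonDyer.BirchSwinnertonDyer.Theorems.GenusKolyTwistingPrime

section DescentPow

variable (W : WeierstrassCurve ℚ) [W.IsElliptic] (p : ℕ) [hp : Fact p.Prime]
variable (F : Type) [Field F] [NumberField F]

omit [W.IsElliptic] hp in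
/-- **All of `Γ_F` commutes with `μ_F^k = e μ^k e⁻¹` when `√−p ∈ F`.** [cite: Rubin1999, Cor. 5.5] -/
theorem apply_pow_smul_eq_of_sqrt_mem {y : F} (hy : y ^ 2 = -(p : F))
    {s : AlgebraicClosure ℚ} {μ : AddMonoid.End W.geomPoints}
    (hs : s ^ 2 = ((-(p : ℤ) : ℤ) : AlgebraicClosure ℚ))
    (hcomm : ∀ g : absoluteGaloisGroup ℚ, g • s = s → ∀ P, μ (g • P) = g • μ P) (k : ℕ)
    (g : absoluteGaloisGroup F) (X : geomPoints (W.baseChange F)) :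
    RatClosure.pointsEquiv (K := F) W ((μ ^ k) ((RatClosure.pointsEquiv (K := F) W).symm (g • X))) =
      g • RatClosure.pointsEquiv (K := F) W ((μ ^ k) ((RatClosure.pointsEquiv (K := F) W).symm X)) := by
  set e := RatClosure.pointsEquiv (K := F) W with he
  have hfix := restrict_smul_sqrt_eq_of_sq_eq p F hy hs g
  obtain ⟨Y, rfl⟩ := e.surjective X
  rw [← RatClosure.pointsEquiv_smul, e.symm_apply_apply, e.symm_apply_apply,
    pow_apply_smul W (hcomm _ hfix) k, RatClosure.pointsEquiv_smul]

/-- **`𝔭`-adic depth of a Kummer class = `𝔭`-adic divisibility of the point (level `p^M`).**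
`W/ℚ` CM, `p ≥ 5` CM-ramified, `μ = √−p` with its sign rule, `F ∋ √−p` with `(p−1) ∤ [F:ℚ]`,
`μ_F^k = e μ^k e⁻¹`, `M ≥ 1`, `P ∈ W(F)`, `p^M Q = P`, any `k`: some evaluation of
`κ_Q ∈ H¹(F, W[p^M])` on `Γ_{F(W[p^M])}` lies outside `ker μ^k` **iff** `μ_F^k P ≠ p^M R` for every
`R ∈ W(F)`. (File 8g gives this with `R` fixed only by `Γ_{F(W[p^M])}`; if `p^M R = μ_F^k P ∈ W(F)`
the Kummer class of `R` dies on `Γ_{F(W[p^M])}`, hence vanishes by (α) over `F` at level `p^M`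
— `eq_zero_of_forall_h1Eval_eq_zero_of_sqrt_mem` — so `R ∈ W(F) + W[p^M]`.)
[cite: GrossLMS1991, §9] [cite: McCallumLMS1991, §3 (2)] [cite: SilvermanAEC2009, VIII.2] -/
theorem exists_h1Eval_kummer_pow_ne_iff_of_sqrt_mem (hCM : W.HasCM) (h5 : 5 ≤ p)
    (hram : CMRamified W p) {s : AlgebraicClosure ℚ} {μ : AddMonoid.End W.geomPoints} {m : ℤ}
    (hs : s ^ 2 = ((-(p : ℤ) : ℤ) : AlgebraicClosure ℚ)) (hm : m.natAbs = p)
    (hμμ : ∀ P, μ (μ P) = m • P)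
    (hcomm : ∀ g : absoluteGaloisGroup ℚ, g • s = s → ∀ P, μ (g • P) = g • μ P)
    (hanti : ∀ g : absoluteGaloisGroup ℚ, g • s = -s → ∀ P, μ (g • P) = -(g • μ P))
    (hF : ∃ y : F, y ^ 2 = -(p : F)) (hdeg : ¬ (p - 1) ∣ Module.finrank ℚ F)
    {M : ℕ} (hM : 1 ≤ M) (k : ℕ) {P : geomPoints (W.baseChange F)}
    (hP : P ∈ MulAction.fixedPoints (absoluteGaloisGroup F) (geomPoints (W.baseChange F)))
    (Q : geomPoints (W.baseChange F)) (hQP : ((p ^ M : ℕ) : ℤ) • Q = P) :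
    (∃ ρ ∈ torsionFixing (W.baseChange F) ((p ^ M : ℕ) : ℤ),
        (μ ^ k) ((RatClosure.torsionEquiv (K := F) W ((p ^ M : ℕ) : ℤ)).symm
          (h1Eval (W.baseChange F) ((p ^ M : ℕ) : ℤ)
            ((W.baseChange F).kummerClassTorsion ((p ^ M : ℕ) : ℤ) Q (by rw [hQP]; exact hP)) ρ) :
              W.geomTorsion ((p ^ M : ℕ) : ℤ)) ≠ 0) ↔
      ¬ ∃ R ∈ MulAction.fixedPoints (absoluteGaloisGroup F) (geomPoints (W.baseChange F)),
        RatClosure.pointsEquiv (K := F) W ((μ ^ k) ((RatClosure.pointsEquiv (K := F) W).symm P)) =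
          ((p ^ M : ℕ) : ℤ) • R := by
  have hpr : p.Prime := hp.out
  obtain ⟨y, hy⟩ := hF
  set e := RatClosure.pointsEquiv (K := F) W with he
  have hpn : (p : ℤ) ∣ ((p ^ M : ℕ) : ℤ) := by exact_mod_cast dvd_pow_self p (by omega : M ≠ 0)
  have key := exists_h1Eval_kummer_not_mem_iff_of_cmRamified W p F h5 hs hm hμμ hcomm hanti hpn k Q
    (by rw [hQP]; exact hP)
  rw [key, hQP, not_iff_not]
  constructor
  · -- descent from `Γ_{F(W[p^M])}`-fixed to `Γ_F`-fixed
    rintro ⟨R, hRfix, hR⟩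
    have hμP : e ((μ ^ k) (e.symm P)) ∈
        MulAction.fixedPoints (absoluteGaloisGroup F) (geomPoints (W.baseChange F)) := fun g => by
      rw [← apply_pow_smul_eq_of_sqrt_mem W p F hy hs hcomm k g P, hP g]
    have hpR : ((p ^ M : ℕ) : ℤ) • R ∈
        MulAction.fixedPoints (absoluteGaloisGroup F) (geomPoints (W.baseChange F)) := by
      rw [← hR]; exact hμP
    set x := (W.baseChange F).kummerClassTorsion ((p ^ M : ℕ) : ℤ) R hpR with hx
    have hx0 : ∀ ρ ∈ torsionFixing (W.baseChange F) ((p ^ M : ℕ) : ℤ),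
        h1Eval (W.baseChange F) ((p ^ M : ℕ) : ℤ) x ρ = 0 := by
      intro ρ hρ
      apply Subtype.ext
      rw [hx, coe_h1Eval_kummerClassTorsion (W.baseChange F) _ R hpR hρ, hRfix ρ hρ, sub_self]
      rfl
    have hxz : x = 0 :=
      eq_zero_of_forall_h1Eval_eq_zero_of_sqrt_mem W p F hCM h5 hram ⟨y, hy⟩ hdeg hM hx0
    obtain ⟨T, hT, hRT⟩ :=
      (WeierstrassCurve.kummerClassTorsion_eq_zero_iff (W.baseChange F) _ R hpR).mp hxz
    refine ⟨R - T, hRT, ?_⟩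
    rw [smul_sub, (mem_geomTorsion_iff _ _ T).mp hT, sub_zero, hR]
  · rintro ⟨R, hRfix, hR⟩
    exact ⟨R, fun ρ _ => hRfix ρ, hR⟩

end DescentPow

end Summit.BirchSwinnertonDyer.BirchSwinnertonDyer.Theorems.PrintCFram.BorelKolyvaginPairing

end
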